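import Summits.QuantumFields.YangMills.Theorems.AtomicSynthesisRiemannFloor

/-!
# AtomicSynthesis (stmt-QuantumFields-28126), stub `stub_singleSlot`, step H4b — derivatives of the mollification-minus-Riemann-sum
error

Prover w4 g22 (free hands), toward H4b `RiemannDisc` of planner ym-idea-11 g14's split of `stub_singleSlot`
(`Theorems/AtomicSynthesisSingleSlotReduction`).  For a smooth compactly supported kernel `Φ : ℝ⁴ → F` and a bounded
Lipschitz weight `f`, the error functional
`E_Φ(x) = ∫ f(y) • Φ(x − y) dy − Σ_{k ∈ S} (h⁴ f(hk)) • Φ(x − hk)`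
is differentiable with `fderiv E_Φ = E_{fderiv Φ}` (differentiation under the integral sign,
`hasFDerivAt_integral_of_dominated_of_fderiv_le`), so by induction on the order — moving one derivative at a time onto the
kernel, `‖D^{m+1} E_Φ‖ = ‖D^m E_{DΦ}‖` — the floor Riemann-sum estimate of `AtomicSynthesisRiemannFloor` gives
**`norm_iteratedFDeriv_molliError_le`**:
`‖D^m E_Φ(x)‖ ≤ 2h (A₀ M_{m+1} + A₁ M_m) (r + 2h)⁴ vol(B₁)` when `|f| ≤ A₀`, `f` is `A₁`-Lipschitz, `tsupport Φ ⊆ B̄(0,r)` and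
`‖D^j Φ‖ ≤ M_j`.  Mathlib only (plus the floor file); def-free.
No stub/crux/rung/summit is closed by this file; nothing here touches Yang–Mills; the YM mass gap is NOT proved. [folklore]
-/

set_option autoImplicit false

noncomputable section

open MeasureTheory Set Metric Filter
open scoped ContDiff Topology
open Literature.MathematicalPhysics.QuantumLattice (siteToE)
open Summit.QuantumFields.YangMills.Cruxes.AtomicSynthesis.RiemannFloor (norm_integral_sub_riemannSum_le)

namespace Summit.QuantumFields.YangMills.Cruxes.AtomicSynthesis.RiemannDeriv

universe u

variable {F : Type u} [NormedAddCommGroup F] [NormedSpace ℝ F] [CompleteSpace F]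

/-! ## Differentiation under the integral sign -/

/-- A continuous compactly supported function into a normed group is bounded. -/
theorem exists_norm_le_of_hasCompactSupport {X : Type*} [NormedAddCommGroup X] (g : EuclideanSpace ℝ (Fin 4) → X)
    (hg : Continuous g) (hgc : HasCompactSupport g) : ∃ C : ℝ, 0 ≤ C ∧ ∀ y, ‖g y‖ ≤ C := by
  obtain ⟨C, hC⟩ := hgc.isCompact.exists_bound_of_continuousOn hg.continuousOn
  refine ⟨max C 0, le_max_right _ _, fun y => ?_⟩
  by_cases hy : y ∈ tsupport g
  · exact (hC y hy).trans (le_max_left _ _)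
  · rw [image_eq_zero_of_notMem_tsupport hy, norm_zero]; exact le_max_right _ _

omit [CompleteSpace F] in
/-- **Differentiation under the integral sign** for `x ↦ ∫ f(y) • Φ(x − y) dy` with `Φ ∈ C¹_c` and `f` continuous. [folklore] -/
theorem hasFDerivAt_integral_smul_kernel (f : EuclideanSpace ℝ (Fin 4) → ℝ) (hf : Continuous f)
    (Φ : EuclideanSpace ℝ (Fin 4) → F) (hΦ : ContDiff ℝ 1 Φ) (hΦc : HasCompactSupport Φ) (x₀ : EuclideanSpace ℝ (Fin 4)) :
    HasFDerivAt (fun x => ∫ y, f y • Φ (x - y)) (∫ y, f y • fderiv ℝ Φ (x₀ - y)) x₀ := by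
  have hΦcont : Continuous Φ := hΦ.continuous
  have hDΦcont : Continuous (fderiv ℝ Φ) := hΦ.continuous_fderiv one_ne_zero
  have hDΦc : HasCompactSupport (fderiv ℝ Φ) := hΦc.fderiv ℝ
  obtain ⟨M₁, hM₁0, hM₁⟩ := exists_norm_le_of_hasCompactSupport _ hDΦcont hDΦc
  -- support radius of `Φ`
  obtain ⟨r, hr⟩ : ∃ r : ℝ, tsupport Φ ⊆ closedBall 0 r :=
    (hΦc.isCompact.isBounded).subset_closedBall 0
  -- on the ball `‖x - x₀‖ < 1`, the integrands live in `closedBall x₀ (r + 1)`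
  set B : Set (EuclideanSpace ℝ (Fin 4)) := closedBall x₀ (|r| + 1) with hB
  have hzero : ∀ x ∈ ball x₀ 1, ∀ y, y ∉ B → fderiv ℝ Φ (x - y) = 0 := by
    intro x hx y hy
    apply image_eq_zero_of_notMem_tsupport
    intro hmem
    have h1 := hr (tsupport_fderiv_subset ℝ hmem)
    rw [mem_closedBall, dist_zero_right] at h1
    rw [hB, mem_closedBall, dist_comm, dist_eq_norm] at hy
    rw [mem_ball, dist_eq_norm] at hx
    have : ‖x₀ - y‖ ≤ ‖x₀ - x‖ + ‖x - y‖ := norm_sub_le_norm_sub_add_norm_sub _ _ _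
    have h2 : ‖x₀ - x‖ = ‖x - x₀‖ := norm_sub_rev _ _
    linarith [le_abs_self r]
  obtain ⟨A, hA0, hA⟩ : ∃ A : ℝ, 0 ≤ A ∧ ∀ y ∈ B, |f y| ≤ A := by
    obtain ⟨A, hA⟩ := (isCompact_closedBall x₀ (|r| + 1)).exists_bound_of_continuousOn hf.continuousOn
    exact ⟨max A 0, le_max_right _ _, fun y hy => (hA y hy).trans (le_max_left _ _)⟩
  refine hasFDerivAt_integral_of_dominated_of_fderiv_le (𝕜 := ℝ) (μ := volume) (x₀ := x₀)
    (F := fun x y => f y • Φ (x - y)) (F' := fun x y => f y • fderiv ℝ Φ (x - y)) (s := ball x₀ 1)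
    (bound := B.indicator fun _ => A * M₁) (ball_mem_nhds x₀ one_pos) ?_ ?_ ?_ ?_ ?_ ?_
  · exact Eventually.of_forall fun x =>
      (hf.smul (hΦcont.comp (continuous_const.sub continuous_id))).aestronglyMeasurable
  · have hcs : HasCompactSupport (fun y : EuclideanSpace ℝ (Fin 4) => f y • Φ (x₀ - y)) := by
      have h1 : HasCompactSupport (fun y : EuclideanSpace ℝ (Fin 4) => Φ (x₀ - y)) := by
        have := hΦc.comp_homeomorph (Homeomorph.subLeft x₀)
        convert this using 1
        funext y
        simp [Homeomorph.subLeft]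
      exact h1.smul_left
    exact (hf.smul (hΦcont.comp (continuous_const.sub continuous_id))).integrable_of_hasCompactSupport hcs
  · exact (hf.smul (hDΦcont.comp (continuous_const.sub continuous_id))).aestronglyMeasurable
  · refine Eventually.of_forall fun y x hx => ?_
    by_cases hy : y ∈ B
    · rw [indicator_of_mem hy, norm_smul, Real.norm_eq_abs]
      exact mul_le_mul (hA y hy) (hM₁ _) (norm_nonneg _) hA0
    · rw [indicator_of_notMem hy, hzero x hx y hy, smul_zero, norm_zero]
  · exact (integrable_indicator_iff measurableSet_closedBall).2 (integrableOn_const (measure_closedBall_lt_top.ne))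
  · refine Eventually.of_forall fun y x _ => ?_
    have h1 : HasFDerivAt (fun x : EuclideanSpace ℝ (Fin 4) => x - y) (ContinuousLinearMap.id ℝ _) x :=
      (hasFDerivAt_id x).sub_const y
    have h2 : HasFDerivAt Φ (fderiv ℝ Φ (x - y)) (x - y) :=
      (hΦ.differentiable one_ne_zero).differentiableAt.hasFDerivAt
    have h3 := (h2.comp x h1).const_smul (f y)
    rwa [ContinuousLinearMap.comp_id] at h3

/-! ## The error functional and its derivative -/

omit [CompleteSpace F] in
/-- **`fderiv E_Φ = E_{fderiv Φ}`**: the derivative of the mollification-minus-Riemann-sum error for the kernel `Φ` is the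
same error for the kernel `fderiv Φ`. [folklore] -/
theorem fderiv_molliError (f : EuclideanSpace ℝ (Fin 4) → ℝ) (hf : Continuous f) (Φ : EuclideanSpace ℝ (Fin 4) → F)
    (hΦ : ContDiff ℝ 1 Φ) (hΦc : HasCompactSupport Φ) (h : ℝ) (S : Finset (Fin 4 → ℤ)) :
    fderiv ℝ (fun x => (∫ y, f y • Φ (x - y)) -
        ∑ k ∈ S, (h ^ 4 * f (h • siteToE k)) • Φ (x - h • siteToE k)) =
      fun x => (∫ y, f y • fderiv ℝ Φ (x - y)) -
        ∑ k ∈ S, (h ^ 4 * f (h • siteToE k)) • fderiv ℝ Φ (x - h • siteToE k) := by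
  funext x
  apply HasFDerivAt.fderiv
  refine (hasFDerivAt_integral_smul_kernel f hf Φ hΦ hΦc x).sub ?_
  have hk : ∀ k ∈ S, HasFDerivAt (fun x : EuclideanSpace ℝ (Fin 4) => (h ^ 4 * f (h • siteToE k)) • Φ (x - h • siteToE k))
      ((h ^ 4 * f (h • siteToE k)) • fderiv ℝ Φ (x - h • siteToE k)) x := by
    intro k _
    have h1 : HasFDerivAt (fun x : EuclideanSpace ℝ (Fin 4) => x - h • siteToE k) (ContinuousLinearMap.id ℝ _) x :=
      (hasFDerivAt_id x).sub_const _
    have h2 : HasFDerivAt Φ (fderiv ℝ Φ (x - h • siteToE k)) (x - h • siteToE k) :=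
      (hΦ.differentiable one_ne_zero).differentiableAt.hasFDerivAt
    have h3 := (h2.comp x h1).const_smul (h ^ 4 * f (h • siteToE k))
    rwa [ContinuousLinearMap.comp_id] at h3
  exact HasFDerivAt.fun_sum hk

/-! ## The derivative bounds, by induction on the order -/

omit [CompleteSpace F] in
/-- A `C^∞` function whose derivatives of all orders are bounded by `M`: the Lipschitz bound with constant `M 1`. -/
theorem lipschitz_of_iteratedFDeriv_le (Φ : EuclideanSpace ℝ (Fin 4) → F) (hΦ : ContDiff ℝ ∞ Φ) (M : ℕ → ℝ)
    (hM : ∀ j y, ‖iteratedFDeriv ℝ j Φ y‖ ≤ M j) (a b : EuclideanSpace ℝ (Fin 4)) :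
    ‖Φ a - Φ b‖ ≤ M 1 * ‖a - b‖ := by
  have hd : Differentiable ℝ Φ := hΦ.differentiable (by simp)
  have hbound : ∀ z ∈ (Set.univ : Set (EuclideanSpace ℝ (Fin 4))), ‖fderiv ℝ Φ z‖ ≤ M 1 := by
    intro z _
    rw [← norm_iteratedFDeriv_zero (𝕜 := ℝ) (f := fderiv ℝ Φ), norm_iteratedFDeriv_fderiv]
    exact hM 1 z
  exact convex_univ.norm_image_sub_le_of_norm_fderiv_le (fun z _ => hd.differentiableAt) hbound (mem_univ b) (mem_univ a)

/-- **Derivative bounds for the mollification-minus-Riemann-sum error**, all orders: if `|f| ≤ A₀`, `f` is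
`A₁`-Lipschitz, `Φ ∈ C^∞` with `tsupport Φ ⊆ B̄(0, r)` and `‖D^j Φ‖ ≤ M_j`, then for every finite `S` containing the mesh
indices where `f ≠ 0`,
`‖D^m E_Φ(x)‖ ≤ 2h (A₀ M_{m+1} + A₁ M_m) (r + 2h)⁴ vol(B₁)`.
Induction on `m`: the base case is the floor Riemann-sum estimate for `y ↦ f(y) • Φ(x − y)`, the step is
`‖D^{m+1} E_Φ‖ = ‖D^m (fderiv E_Φ)‖ = ‖D^m E_{fderiv Φ}‖`. [folklore] -/
theorem norm_iteratedFDeriv_molliError_le (f : EuclideanSpace ℝ (Fin 4) → ℝ) (hf : Continuous f) {A₀ A₁ : ℝ}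
    (hA₀ : 0 ≤ A₀) (hA₁ : 0 ≤ A₁) (hfb : ∀ y, |f y| ≤ A₀) (hfl : ∀ y y', |f y - f y'| ≤ A₁ * ‖y - y'‖)
    {h : ℝ} (hh : 0 < h) (S : Finset (Fin 4 → ℤ)) (hS : ∀ k, f (h • siteToE k) ≠ 0 → k ∈ S) {r : ℝ} (hr : 0 ≤ r)
    (m : ℕ) :
    ∀ (Φ : EuclideanSpace ℝ (Fin 4) → F), ContDiff ℝ ∞ Φ → tsupport Φ ⊆ closedBall 0 r →
      ∀ (M : ℕ → ℝ), (∀ j, 0 ≤ M j) → (∀ j y, ‖iteratedFDeriv ℝ j Φ y‖ ≤ M j) →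
        ∀ x, ‖iteratedFDeriv ℝ m (fun x => (∫ y, f y • Φ (x - y)) -
          ∑ k ∈ S, (h ^ 4 * f (h • siteToE k)) • Φ (x - h • siteToE k)) x‖ ≤
          2 * h * (A₀ * M (m + 1) + A₁ * M m) * ((r + 2 * h) ^ 4 * (volume (ball (0 : EuclideanSpace ℝ (Fin 4)) 1)).toReal) := by
  induction m generalizing F with
  | zero =>
    intro Φ hΦ hsupp M hM0 hM x
    rw [norm_iteratedFDeriv_zero]
    have hΦcont : Continuous Φ := hΦ.continuous
    have hM0' : ∀ w, ‖Φ w‖ ≤ M 0 := fun w => by rw [← norm_iteratedFDeriv_zero (𝕜 := ℝ) (f := Φ)]; exact hM 0 w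
    have hlipΦ := lipschitz_of_iteratedFDeriv_le Φ hΦ M hM
    -- the integrand `G_x`
    have hG : Continuous fun y : EuclideanSpace ℝ (Fin 4) => f y • Φ (x - y) :=
      hf.smul (hΦcont.comp (continuous_const.sub continuous_id))
    have hsuppG : ∀ y : EuclideanSpace ℝ (Fin 4), f y • Φ (x - y) ≠ 0 → ‖y - x‖ ≤ r := by
      intro y hy
      have h1 : Φ (x - y) ≠ 0 := by
        intro h0; exact hy (by rw [h0, smul_zero])
      have h2 := hsupp (subset_tsupport _ (Function.mem_support.mpr h1))
      rw [mem_closedBall, dist_zero_right] at h2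
      rwa [norm_sub_rev]
    have hlipG : ∀ y y' : EuclideanSpace ℝ (Fin 4),
        ‖f y • Φ (x - y) - f y' • Φ (x - y')‖ ≤ (A₀ * M 1 + A₁ * M 0) * ‖y - y'‖ := by
      intro y y'
      have e : f y • Φ (x - y) - f y' • Φ (x - y') =
          f y • (Φ (x - y) - Φ (x - y')) + (f y - f y') • Φ (x - y') := by
        rw [smul_sub, sub_smul]; abel
      rw [e]
      have h1 : ‖f y • (Φ (x - y) - Φ (x - y'))‖ ≤ A₀ * (M 1 * ‖y - y'‖) := by
        rw [norm_smul, Real.norm_eq_abs]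
        refine mul_le_mul (hfb y) ?_ (norm_nonneg _) hA₀
        have := hlipΦ (x - y) (x - y')
        rwa [show x - y - (x - y') = y' - y by abel, norm_sub_rev y' y] at this
      have h2 : ‖(f y - f y') • Φ (x - y')‖ ≤ A₁ * ‖y - y'‖ * M 0 := by
        rw [norm_smul, Real.norm_eq_abs]
        exact mul_le_mul (hfl y y') (hM0' _) (norm_nonneg _) (by positivity)
      calc ‖f y • (Φ (x - y) - Φ (x - y')) + (f y - f y') • Φ (x - y')‖
          ≤ ‖f y • (Φ (x - y) - Φ (x - y'))‖ + ‖(f y - f y') • Φ (x - y')‖ := norm_add_le _ _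
        _ ≤ A₀ * (M 1 * ‖y - y'‖) + A₁ * ‖y - y'‖ * M 0 := add_le_add h1 h2
        _ = (A₀ * M 1 + A₁ * M 0) * ‖y - y'‖ := by ring
    have hSG : ∀ k : Fin 4 → ℤ, f (h • siteToE k) • Φ (x - h • siteToE k) ≠ 0 → k ∈ S := by
      intro k hk
      refine hS k fun h0 => hk ?_
      rw [h0, zero_smul]
    have key := norm_integral_sub_riemannSum_le hh (fun y => f y • Φ (x - y)) hG x hr
      (add_nonneg (mul_nonneg hA₀ (hM0 1)) (mul_nonneg hA₁ (hM0 0))) hsuppG hlipG S hSG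
    have hsum : ∑ k ∈ S, (h ^ 4 * f (h • siteToE k)) • Φ (x - h • siteToE k) =
        ∑ k ∈ S, (h ^ 4) • (f (h • siteToE k) • Φ (x - h • siteToE k)) :=
      Finset.sum_congr rfl fun k _ => mul_smul _ _ _
    rw [hsum, zero_add]
    calc ‖(∫ y, f y • Φ (x - y)) - ∑ k ∈ S, (h ^ 4) • (f (h • siteToE k) • Φ (x - h • siteToE k))‖
        ≤ 2 * h * (A₀ * M 1 + A₁ * M 0) * ((r + 2 * h) ^ 4 * (volume (ball (0 : EuclideanSpace ℝ (Fin 4)) 1)).toReal) := key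
      _ = 2 * h * (A₀ * M 1 + A₁ * M 0) * ((r + 2 * h) ^ 4 * (volume (ball (0 : EuclideanSpace ℝ (Fin 4)) 1)).toReal) := rfl
  | succ m ih =>
    intro Φ hΦ hsupp M hM0 hM x
    have hΦ1 : ContDiff ℝ 1 Φ := hΦ.of_le (by exact_mod_cast le_top)
    have hΦc : HasCompactSupport Φ :=
      HasCompactSupport.of_support_subset_isCompact (isCompact_closedBall 0 r) (subset_tsupport Φ |>.trans hsupp)
    rw [← norm_iteratedFDeriv_fderiv, fderiv_molliError f hf Φ hΦ1 hΦc h S]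
    have hDΦ : ContDiff ℝ ∞ (fderiv ℝ Φ) := (contDiff_infty_iff_fderiv.1 hΦ).2
    have hDsupp : tsupport (fderiv ℝ Φ) ⊆ closedBall 0 r := (tsupport_fderiv_subset ℝ).trans hsupp
    have hDM : ∀ j y, ‖iteratedFDeriv ℝ j (fderiv ℝ Φ) y‖ ≤ M (j + 1) := fun j y => by
      rw [norm_iteratedFDeriv_fderiv]; exact hM (j + 1) y
    exact ih (fderiv ℝ Φ) hDΦ hDsupp (fun j => M (j + 1)) (fun j => hM0 _) hDM x

end Summit.QuantumFields.YangMills.Cruxes.AtomicSynthesis.RiemannDeriv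

end
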